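import Literature.MathematicalPhysics.QuantumFieldTheory.Balaban1983to89.B9Eq3132TentCurl
import Literature.MathematicalPhysics.QuantumFieldTheory.Balaban1983to89.B9Eq3132EnergyUpper

/-!
# `Balaban1983to89.B9Eq3132TentFlat` — T. Bałaban, *Propagators for lattice gauge theories in a background field*, Commun. Math. Phys. **99** (1985) 389–434
# [Balaban1985BackgroundPropagators], (3.1)–(3.4) pp. 390–391 with [Balaban1985Averaging] (17)–(20) pp. 20–21 and [Balaban1984PropagatorsII] (2.147) p. 248:
# HILBERT–SCHMIDT BOOKKEEPING FOR TRANSPORTED TENTS (overlaps, the lasso defect `R(W)X − X`, the product trick `a² ≤ (a − b)² + 2ab`) AND THE FLAT PROFILE SUMS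
# (gradient energy, mass, the plaquette-to-(bond, direction) injections) — part 1 of step F-d of the (P′1) roadmap

statement-level skeleton of published theorems with citation tags; proofs where landed; nothing here is a claim about the Yang–Mills mass gap

THE PRINT.  [B9] (3.1)–(3.4) pp. 390–391 (`R(U)X = UXU⁻¹`, the covariant curl), (3.69) p. 404; [7] = [Balaban1985Averaging] (17)–(20) (matrix norms `|X|`, `‖X‖`);
[4] p. 248 (2.147) (the energy of the tent test functions).

WHY THIS FILE (dag-n06-i gen 14, N06 bundle F4, row 26).  Row 26's last binder `hP1` (certificate ed. 12) is the `Δ_a(U)`-energy of the transported tent bumps.  The sequel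
`B9Eq3132TentKinetic` bounds the kinetic quantities of ONE transported tent; THIS FILE supplies its elementary currency: Hilbert–Schmidt sums of overlapping tents
(`HS(Σ_{y∈S}F_y) ≤ #S·ΣHS(F_y)`), the cost of a lasso defect (`HS(R(W)X − X) ≤ 4|W − 1|²HS(X)` for a contraction pair `W, W⁻¹`), the pointwise mechanism
`a²·HS(D) ≤ 4(a − b)²HS(X) + 4ϑ²(a² + b²)HS(X)` that charges a defect to the flat DIFFERENCE `a − b` unless both neighbouring profile values are non-zero, and the flat
sums of a profile `θ` on the fine bonds: `gradSq θ = Σ_fΣ_ν(θ(f+e_ν) − θ(f))²`, `massSq θ = Σ_f θ(f)²`, with the two plaquette differences injecting into `gradSq` (the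
tree's `norm_dcE_sq_le` argument) and the four edge values into `4(d+1)·massSq` (n06-j's `sum_edgeY_le`).

WHAT IS PROVED (sorry-free; 3 def: `pdiff`, `gradSq`, `massSq`).
* §1 `hs_sum_le_card_mul`, `hs_sum_le_card_support_mul`, `hs_add_sub_le`, `norm_inv_sub_one_le`, ★ `hs_R_sub_self_le`, `hs_R_sub_self_le_four`,
  `sq_le_sq_sub_add`, ★ `sq_mul_defect_le`.
* §2 `pdiff`, `gradSq`, `massSq`, `gradSq_nonneg`, `massSq_nonneg`, `sum_unshift`, ★ `sum_plaq_le_sum_bond_dir`, `sum_plaq_pdiff_sq_le`, `sum_plaq_edge_sq_le`.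

HONEST SCOPE.  Finite algebra and Cauchy–Schwarz; nothing of [B9] asserted; count-neutral; N06 NOT discharged.  Cell `pub-ymgap` (HUMAN RULING D-0062), Track A node
N06 [B9], seat `pub-ymgap-dag-n06-i` (gen 14), 2026-08-27; a NEW file.
-/

noncomputable section

namespace Literature.MathematicalPhysics.QuantumFieldTheory.Balaban1983to89.B9Eq3132TentFlat

open Node00
open B6KLevelCensusIndexV1 (KIdx)
open B6GlobalChartV1 (PV)
open B9Eq39Adjoint (R R_add R_sub R_mul R_one R_smul R_zero)
open B9Ineq369CurvatureSmallAtLettersY (hs_nonneg hs_mul_left_le hs_mul_right_le hs_smul hs_add_le hs_sub_le hs_R_le contractive_of_mem_unitary)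
open B9Thm311PosOfPrincipalAtLettersY (sum_edgeY_le)
open B9Eq3132TentCurl (tentField curlY_tentField divY_tentField)
open B9Thm311FlippedBondLetters (hs_real_smul)
open scoped Matrix Matrix.Norms.L2Operator

variable {N : ℕ}

/-! ## §1 Hilbert–Schmidt bookkeeping -/

section HS

/-- **OVERLAPS**: `HS(Σ_{y∈S} F_y) ≤ #S·Σ_{y∈S} HS(F_y)` (Cauchy–Schwarz entrywise). [cite: Balaban1984PropagatorsII, (2.147) p.248, bookkeeping] -/
theorem hs_sum_le_card_mul {ι : Type*} (S : Finset ι) (F : ι → Matrix (Fin N) (Fin N) ℂ) :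
    ∑ a, ∑ b, ‖(∑ y ∈ S, F y) a b‖ ^ 2 ≤ S.card * ∑ y ∈ S, ∑ a, ∑ b, ‖F y a b‖ ^ 2 := by
  have hcomm : ∑ y ∈ S, ∑ a, ∑ b, ‖F y a b‖ ^ 2 = ∑ a, ∑ b, ∑ y ∈ S, ‖F y a b‖ ^ 2 := by
    rw [Finset.sum_comm]
    exact Finset.sum_congr rfl fun a _ => Finset.sum_comm
  rw [hcomm, Finset.mul_sum]
  refine Finset.sum_le_sum fun a _ => ?_
  rw [Finset.mul_sum]
  refine Finset.sum_le_sum fun b _ => ?_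
  rw [Matrix.sum_apply]
  calc ‖∑ y ∈ S, F y a b‖ ^ 2 ≤ (∑ y ∈ S, ‖F y a b‖) ^ 2 := pow_le_pow_left₀ (norm_nonneg _) (norm_sum_le _ _) 2
    _ ≤ S.card * ∑ y ∈ S, ‖F y a b‖ ^ 2 := sq_sum_le_card_mul_sum_sq

/-- the same over a support: `F` vanishes off `S`. [cite: Balaban1984PropagatorsII, (2.147) p.248, bookkeeping] -/
theorem hs_sum_le_card_support_mul {ι : Type*} [Fintype ι] (S : Finset ι) (F : ι → Matrix (Fin N) (Fin N) ℂ) (hS : ∀ y, F y ≠ 0 → y ∈ S) :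
    ∑ a, ∑ b, ‖(∑ y, F y) a b‖ ^ 2 ≤ S.card * ∑ y, ∑ a, ∑ b, ‖F y a b‖ ^ 2 := by
  classical
  have h1 : ∑ y, F y = ∑ y ∈ S, F y := by
    rw [← Finset.sum_subset (Finset.subset_univ S)]
    intro y _ hy
    by_contra h
    exact hy (hS y h)
  have h2 : ∑ y ∈ S, ∑ a, ∑ b, ‖F y a b‖ ^ 2 ≤ ∑ y, ∑ a, ∑ b, ‖F y a b‖ ^ 2 :=
    Finset.sum_le_sum_of_subset_of_nonneg (Finset.subset_univ S) fun y _ _ => hs_nonneg _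
  rw [h1]
  exact (hs_sum_le_card_mul S F).trans (mul_le_mul_of_nonneg_left h2 (Nat.cast_nonneg _))

/-- `HS(a + b − c) ≤ 2HS(a) + 4HS(b) + 4HS(c)`. [cite: Balaban1985Averaging, (17) p.20, bookkeeping] -/
theorem hs_add_sub_le (X Y Z : Matrix (Fin N) (Fin N) ℂ) :
    ∑ a, ∑ b, ‖(X + Y - Z) a b‖ ^ 2 ≤ 2 * ∑ a, ∑ b, ‖X a b‖ ^ 2 + 4 * ∑ a, ∑ b, ‖Y a b‖ ^ 2 + 4 * ∑ a, ∑ b, ‖Z a b‖ ^ 2 := by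
  have h1 := hs_add_le X (Y - Z)
  have h2 := hs_sub_le Y Z
  rw [← add_sub_assoc] at h1
  linarith

/-- for a contraction pair `V, V⁻¹`: `|V⁻¹ − 1| ≤ |V − 1|` (`V⁻¹ − 1 = V⁻¹(1 − V)`). [cite: Balaban1985BackgroundPropagators, (3.5) p.391 (U(−∂p) = U(∂p)⁻¹), bookkeeping] -/
theorem norm_inv_sub_one_le {𝔸 : Type*} [NormedRing 𝔸] {V : 𝔸ˣ} (hV : ‖((V⁻¹ : 𝔸ˣ) : 𝔸)‖ ≤ 1) :
    ‖((V⁻¹ : 𝔸ˣ) : 𝔸) - 1‖ ≤ ‖(V : 𝔸) - 1‖ := by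
  have e : ((V⁻¹ : 𝔸ˣ) : 𝔸) - 1 = ((V⁻¹ : 𝔸ˣ) : 𝔸) * (1 - (V : 𝔸)) := by
    rw [mul_sub, mul_one, Units.inv_mul]
  rw [e]
  calc _ ≤ ‖((V⁻¹ : 𝔸ˣ) : 𝔸)‖ * ‖1 - (V : 𝔸)‖ := norm_mul_le _ _
    _ ≤ 1 * ‖1 - (V : 𝔸)‖ := mul_le_mul_of_nonneg_right hV (norm_nonneg _)
    _ = ‖(V : 𝔸) - 1‖ := by rw [one_mul, norm_sub_rev]

/-- ★ **THE LASSO DEFECT COSTS `2|W − 1|`**: for a contraction pair `W, W⁻¹`, `HS(R(W)X − X) ≤ 4|W − 1|²·HS(X)`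
(`WXW⁻¹ − X = (W − 1)XW⁻¹ + X(W⁻¹ − 1)`). [cite: Balaban1985BackgroundPropagators, (3.40) p.397, (3.69) p.404] -/
theorem hs_R_sub_self_le {W : (Matrix (Fin N) (Fin N) ℂ)ˣ}
    (hW : ‖(W : Matrix (Fin N) (Fin N) ℂ)‖ ≤ 1 ∧ ‖((W⁻¹ : (Matrix (Fin N) (Fin N) ℂ)ˣ) : Matrix (Fin N) (Fin N) ℂ)‖ ≤ 1) {ϑ : ℝ}
    (hϑ : ‖(W : Matrix (Fin N) (Fin N) ℂ) - 1‖ ≤ ϑ) (X : Matrix (Fin N) (Fin N) ℂ) :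
    ∑ a, ∑ b, ‖(R W X - X) a b‖ ^ 2 ≤ 4 * ϑ ^ 2 * ∑ a, ∑ b, ‖X a b‖ ^ 2 := by
  have e : R W X - X = ((W : Matrix (Fin N) (Fin N) ℂ) - 1) * (X * ((W⁻¹ : (Matrix (Fin N) (Fin N) ℂ)ˣ) : Matrix (Fin N) (Fin N) ℂ)) +
      X * (((W⁻¹ : (Matrix (Fin N) (Fin N) ℂ)ˣ) : Matrix (Fin N) (Fin N) ℂ) - 1) := by
    unfold R; noncomm_ring
  rw [e]
  have h1 := hs_add_le (((W : Matrix (Fin N) (Fin N) ℂ) - 1) * (X * ((W⁻¹ : (Matrix (Fin N) (Fin N) ℂ)ˣ) : Matrix (Fin N) (Fin N) ℂ)))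
    (X * (((W⁻¹ : (Matrix (Fin N) (Fin N) ℂ)ˣ) : Matrix (Fin N) (Fin N) ℂ) - 1))
  have h2 := hs_mul_left_le ((W : Matrix (Fin N) (Fin N) ℂ) - 1) (X * ((W⁻¹ : (Matrix (Fin N) (Fin N) ℂ)ˣ) : Matrix (Fin N) (Fin N) ℂ))
  have h3 := hs_mul_right_le X ((W⁻¹ : (Matrix (Fin N) (Fin N) ℂ)ˣ) : Matrix (Fin N) (Fin N) ℂ)
  have h4 := hs_mul_right_le X (((W⁻¹ : (Matrix (Fin N) (Fin N) ℂ)ˣ) : Matrix (Fin N) (Fin N) ℂ) - 1)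
  have hX := hs_nonneg X
  have hXW := hs_nonneg (X * ((W⁻¹ : (Matrix (Fin N) (Fin N) ℂ)ˣ) : Matrix (Fin N) (Fin N) ℂ))
  have hi := norm_inv_sub_one_le hW.2
  have n1 : ‖(W : Matrix (Fin N) (Fin N) ℂ) - 1‖ ^ 2 ≤ ϑ ^ 2 := pow_le_pow_left₀ (norm_nonneg _) hϑ 2
  have n2 : ‖((W⁻¹ : (Matrix (Fin N) (Fin N) ℂ)ˣ) : Matrix (Fin N) (Fin N) ℂ) - 1‖ ^ 2 ≤ ϑ ^ 2 := pow_le_pow_left₀ (norm_nonneg _) (hi.trans hϑ) 2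
  have n3 : ‖((W⁻¹ : (Matrix (Fin N) (Fin N) ℂ)ˣ) : Matrix (Fin N) (Fin N) ℂ)‖ ^ 2 ≤ 1 := by
    nlinarith [hW.2, norm_nonneg (((W⁻¹ : (Matrix (Fin N) (Fin N) ℂ)ˣ) : Matrix (Fin N) (Fin N) ℂ))]
  have h3' : ∑ a, ∑ b, ‖(X * ((W⁻¹ : (Matrix (Fin N) (Fin N) ℂ)ˣ) : Matrix (Fin N) (Fin N) ℂ)) a b‖ ^ 2 ≤ ∑ a, ∑ b, ‖X a b‖ ^ 2 :=
    h3.trans (by nlinarith)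
  have h2' : ∑ a, ∑ b, ‖(((W : Matrix (Fin N) (Fin N) ℂ) - 1) * (X * ((W⁻¹ : (Matrix (Fin N) (Fin N) ℂ)ˣ) : Matrix (Fin N) (Fin N) ℂ))) a b‖ ^ 2 ≤
      ϑ ^ 2 * ∑ a, ∑ b, ‖X a b‖ ^ 2 :=
    h2.trans (mul_le_mul n1 h3' hXW (sq_nonneg _))
  have h4' : ∑ a, ∑ b, ‖(X * (((W⁻¹ : (Matrix (Fin N) (Fin N) ℂ)ˣ) : Matrix (Fin N) (Fin N) ℂ) - 1)) a b‖ ^ 2 ≤ ϑ ^ 2 * ∑ a, ∑ b, ‖X a b‖ ^ 2 :=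
    h4.trans (mul_le_mul_of_nonneg_right n2 hX)
  linarith

/-- the crude companion: `HS(R(W)X − X) ≤ 4·HS(X)` for a contraction pair. [cite: Balaban1985BackgroundPropagators, (3.1) p.390, bookkeeping] -/
theorem hs_R_sub_self_le_four {W : (Matrix (Fin N) (Fin N) ℂ)ˣ}
    (hW : ‖(W : Matrix (Fin N) (Fin N) ℂ)‖ ≤ 1 ∧ ‖((W⁻¹ : (Matrix (Fin N) (Fin N) ℂ)ˣ) : Matrix (Fin N) (Fin N) ℂ)‖ ≤ 1) (X : Matrix (Fin N) (Fin N) ℂ) :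
    ∑ a, ∑ b, ‖(R W X - X) a b‖ ^ 2 ≤ 4 * ∑ a, ∑ b, ‖X a b‖ ^ 2 := by
  have h1 := hs_sub_le (R W X) X
  have h2 := hs_R_le hW X
  linarith

/-- `a² ≤ (a − b)² + 2ab`. [cite: Balaban1984PropagatorsII, (2.147) p.248, bookkeeping] -/
theorem sq_le_sq_sub_add (a b : ℝ) : a ^ 2 ≤ (a - b) ^ 2 + 2 * (a * b) := by nlinarith [sq_nonneg b]

end HS

/-- ★ the pointwise mechanism: for `a, b ≥ 0` and a defect `D` with `HS(D) ≤ 4HS(X)` always and `HS(D) ≤ 4ϑ²HS(X)` whenever `ab ≠ 0`,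
`a²·HS(D) ≤ 4(a − b)²·HS(X) + 4ϑ²(a² + b²)·HS(X)` (`a² ≤ (a − b)² + 2ab`, `2ab ≤ a² + b²`). [cite: Balaban1984PropagatorsII, (2.147) p.248, bookkeeping] -/
theorem sq_mul_defect_le {a b ϑ hX hD : ℝ} (ha : 0 ≤ a) (hb : 0 ≤ b) (hX0 : 0 ≤ hX) (hD0 : 0 ≤ hD) (h4 : hD ≤ 4 * hX)
    (hsmall : a * b ≠ 0 → hD ≤ 4 * ϑ ^ 2 * hX) :
    a ^ 2 * hD ≤ 4 * (a - b) ^ 2 * hX + 4 * ϑ ^ 2 * (a ^ 2 + b ^ 2) * hX := by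
  have hsq := sq_le_sq_sub_add a b
  have hab : 0 ≤ a * b := mul_nonneg ha hb
  by_cases h0 : a * b = 0
  · rw [h0, mul_zero, add_zero] at hsq
    have h1 : a ^ 2 * hD ≤ (a - b) ^ 2 * hD := mul_le_mul_of_nonneg_right hsq hD0
    have h2 : (a - b) ^ 2 * hD ≤ (a - b) ^ 2 * (4 * hX) := mul_le_mul_of_nonneg_left h4 (sq_nonneg _)
    have h3 : 0 ≤ 4 * ϑ ^ 2 * (a ^ 2 + b ^ 2) * hX := by positivity
    linarith
  · have hs := hsmall h0
    have h1 : a ^ 2 * hD ≤ ((a - b) ^ 2 + 2 * (a * b)) * hD := mul_le_mul_of_nonneg_right hsq hD0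
    have h2 : (a - b) ^ 2 * hD ≤ (a - b) ^ 2 * (4 * hX) := mul_le_mul_of_nonneg_left h4 (sq_nonneg _)
    have h3 : 2 * (a * b) * hD ≤ 2 * (a * b) * (4 * ϑ ^ 2 * hX) := mul_le_mul_of_nonneg_left hs (by positivity)
    have h4' : 2 * (a * b) ≤ a ^ 2 + b ^ 2 := by nlinarith [sq_nonneg (a - b)]
    nlinarith [sq_nonneg ϑ, mul_nonneg (mul_nonneg (sq_nonneg ϑ) hX0) (sub_nonneg.2 h4')]

/-! ## §2 Flat differences of a profile; the plaquette-to-(bond, direction) injections -/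

section Flat

variable {d ℓ : ℕ} {hd : 1 ≤ d + 1} {hL : Odd (ℓ + 1) ∧ 1 < ℓ + 1} {b₀ b₁ : ℝ} (i : KIdx d ℓ hd hL b₀ b₁)

/-- the flat forward difference of a profile: `(Δ_νθ)(f) = θ(f + e_ν) − θ(f)` (the tree's `bdiff` on plain functions). [cite: Balaban1984PropagatorsI, (1.2) p.18, dictionary] -/
def pdiff (θ : FBondY i → ℝ) (ν : Fin (PV d ℓ i.m i.K hd hL).d) (f : FBondY i) : ℝ := θ ⟨f.src.shift ν, f.dir⟩ - θ f

/-- the flat gradient energy `Σ_fΣ_ν (Δ_νθ)(f)²` of a profile. [cite: Balaban1984PropagatorsII, (2.147) p.248, bookkeeping] -/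
def gradSq (θ : FBondY i → ℝ) : ℝ := ∑ f : FBondY i, ∑ ν : Fin (PV d ℓ i.m i.K hd hL).d, pdiff i θ ν f ^ 2

/-- the flat mass `Σ_f θ(f)²` of a profile. [cite: Balaban1984PropagatorsII, (2.147) p.248, bookkeeping] -/
def massSq (θ : FBondY i → ℝ) : ℝ := ∑ f : FBondY i, θ f ^ 2

/-- `gradSq ≥ 0`. [cite: Balaban1984PropagatorsII, (2.147) p.248, bookkeeping] -/
theorem gradSq_nonneg (θ : FBondY i → ℝ) : 0 ≤ gradSq i θ := Finset.sum_nonneg fun _ _ => Finset.sum_nonneg fun _ _ => sq_nonneg _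

/-- `massSq ≥ 0`. [cite: Balaban1984PropagatorsII, (2.147) p.248, bookkeeping] -/
theorem massSq_nonneg (θ : FBondY i → ℝ) : 0 ≤ massSq i θ := Finset.sum_nonneg fun _ _ => sq_nonneg _

omit i in
/-- reindexing a site sum by `x ↦ x − e_κ`. [cite: Balaban1984PropagatorsI, (1.21) p.21, bookkeeping] -/
theorem sum_unshift {P : Params} {M : Type*} [AddCommMonoid M] (κ : Fin P.d) (F : Site P 0 → M) :
    ∑ x : Site P 0, F (x.unshift κ) = ∑ x : Site P 0, F x :=
  Equiv.sum_comp (B10StarCount.shiftEquiv κ).symm F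

/-- ★ **THE TWO PLAQUETTE DIFFERENCES INJECT INTO `Σ_fΣ_ν`**: for `F ≥ 0`, `Σ_p (F(μ_p, ⟨x_p, ν_p⟩) + F(ν_p, ⟨x_p, μ_p⟩)) ≤ Σ_f Σ_ν F(ν, f)` (the images
`(x, ν, μ)` and `(x, μ, ν)`, `μ < ν`, are disjoint). [cite: Balaban1984PropagatorsI, (1.2)∕(1.21) pp.18–21, bookkeeping] -/
theorem sum_plaq_le_sum_bond_dir (F : Fin (PV d ℓ i.m i.K hd hL).d → FBondY i → ℝ) (hF : ∀ ν f, 0 ≤ F ν f) :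
    ∑ p : PlaqY i, (F p.μ ⟨p.src, p.ν⟩ + F p.ν ⟨p.src, p.μ⟩) ≤ ∑ f : FBondY i, ∑ ν : Fin (PV d ℓ i.m i.K hd hL).d, F ν f := by
  classical
  set G : Site (PV d ℓ i.m i.K hd hL) 0 × Fin (PV d ℓ i.m i.K hd hL).d × Fin (PV d ℓ i.m i.K hd hL).d → ℝ := fun t => F t.2.2 ⟨t.1, t.2.1⟩ with hG
  have hG0 : ∀ t, 0 ≤ G t := fun t => hF _ _
  have htot : ∑ f : FBondY i, ∑ ν : Fin (PV d ℓ i.m i.K hd hL).d, F ν f = ∑ t, G t := by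
    rw [B10StarCount.sum_pbond, Fintype.sum_prod_type]
    refine Finset.sum_congr rfl fun x _ => ?_
    rw [Fintype.sum_prod_type]
  have e1inj : Function.Injective (fun p : PlaqY i => (p.src, p.ν, p.μ)) := by
    intro p q h; simp only [Prod.mk.injEq] at h; cases p; cases q; simp only at h; obtain ⟨h1, h2, h3⟩ := h; subst h1; subst h2; subst h3; rfl
  have e2inj : Function.Injective (fun p : PlaqY i => (p.src, p.μ, p.ν)) := by
    intro p q h; simp only [Prod.mk.injEq] at h; cases p; cases q; simp only at h; obtain ⟨h1, h2, h3⟩ := h; subst h1; subst h2; subst h3; rfl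
  have hdisj : Disjoint (Finset.univ.map ⟨_, e1inj⟩) (Finset.univ.map ⟨_, e2inj⟩) := by
    rw [Finset.disjoint_left]
    rintro t ht1 ht2
    rw [Finset.mem_map] at ht1 ht2
    obtain ⟨p, -, hp⟩ := ht1
    obtain ⟨q, -, hq⟩ := ht2
    simp only [Function.Embedding.coeFn_mk] at hp hq
    have h := hp.trans hq.symm
    simp only [Prod.mk.injEq] at h
    have := p.hμν; have := q.hμν
    rw [h.2.1, h.2.2] at *; omega
  have h1 : ∑ p : PlaqY i, F p.μ ⟨p.src, p.ν⟩ = ∑ t ∈ Finset.univ.map ⟨_, e1inj⟩, G t := by rw [Finset.sum_map]; rfl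
  have h2 : ∑ p : PlaqY i, F p.ν ⟨p.src, p.μ⟩ = ∑ t ∈ Finset.univ.map ⟨_, e2inj⟩, G t := by rw [Finset.sum_map]; rfl
  rw [Finset.sum_add_distrib, h1, h2, ← Finset.sum_union hdisj, htot]
  exact Finset.sum_le_sum_of_subset_of_nonneg (Finset.subset_univ _) fun t _ _ => hG0 t

/-- the two plaquette differences of a profile sum to at most its gradient energy. [cite: Balaban1984PropagatorsI, (1.2) p.18; Balaban1984PropagatorsII, (2.147) p.248] -/
theorem sum_plaq_pdiff_sq_le (θ : FBondY i → ℝ) :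
    ∑ p : PlaqY i, (pdiff i θ p.μ ⟨p.src, p.ν⟩ ^ 2 + pdiff i θ p.ν ⟨p.src, p.μ⟩ ^ 2) ≤ gradSq i θ :=
  sum_plaq_le_sum_bond_dir i (fun ν f => pdiff i θ ν f ^ 2) fun _ _ => sq_nonneg _

/-- the four edge values of a plaquette, squared and summed over all plaquettes: `≤ 4(d+1)·massSq` (n06-j's incidence bound).
[cite: Balaban1985BackgroundPropagators, (3.69) p.404; Balaban1984PropagatorsII, (2.147) p.248] -/
theorem sum_plaq_edge_sq_le (θ : FBondY i → ℝ) :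
    ∑ p : PlaqY i, (θ ⟨p.src, p.μ⟩ ^ 2 + θ ⟨p.src.shift p.μ, p.ν⟩ ^ 2 + θ ⟨p.src.shift p.ν, p.μ⟩ ^ 2 + θ ⟨p.src, p.ν⟩ ^ 2) ≤
      4 * (d + 1) * massSq i θ := by
  have h := sum_edgeY_le i (g := fun b => θ b ^ 2) fun _ => sq_nonneg _
  refine le_trans (le_of_eq ?_) h
  refine Finset.sum_congr rfl fun p _ => ?_
  have e0 : edgeY i p 0 = ⟨p.src.shift p.ν, p.μ⟩ := rfl
  have e1 : edgeY i p 1 = ⟨p.src, p.ν⟩ := rfl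
  have e2 : edgeY i p 2 = ⟨p.src, p.μ⟩ := rfl
  have e3 : edgeY i p 3 = ⟨p.src.shift p.μ, p.ν⟩ := rfl
  rw [Fin.sum_univ_four, e0, e1, e2, e3]
  ring

end Flat

end Literature.MathematicalPhysics.QuantumFieldTheory.Balaban1983to89.B9Eq3132TentFlat

end
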